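import Mathlib
import Summits.Ventures.PercRepro2.TypedSepTwoBSupport
import Summits.Ventures.PercRepro2.TypedSepThreeTheorem
import Summits.Ventures.PercRepro2.RootCutTheorem

/-!
# The typed (SEP-2) zero, III (a₃ on the b-side): the theorem (blind cell PercRepro2, p3 g6,
2026-08-25; `proofs/P3-BRIDGE.md` §11.22)

On a (SEP-2) split with `a₃` on the b-side (`Split2`: the roots separate `o` from `a₃` and `b`)
the kernel `K₃` is a side kernel (`K3_eq_side2`), its doubly symmetrised form is `dsym2` on the
side states (`symB_symA_sideΦ2`), which vanishes identically (`dsym2_eq_zero`); by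
`typedCount_side_eq_zero` **every typed base vanishes**: `typedCount_eq_zero_of_split2`, the
`z ≡ false` class `HasSepTwoB` and `typedCount_eq_zero_of_hasSepTwoB` (+ nonnegativity).  The
mechanism is that of the typed (SEP-3) zero (an identity across the separator, then a pointwise
`decide` of the `S₃ × S₃`-symmetrised kernel).  Own work; standard axioms.
-/

namespace Summit.Ventures.PercRepro2

open UnionCluster

namespace CovForm

namespace SepTwo

open OneTyped TypedA3 Untouched TypedFactor Separated RootBridge SepThree

section Main

open Classical

variable {V : Type*} {E : Type*} [Fintype E] [DecidableEq E] {R : Type*} [Field R]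
  [LinearOrder R] [IsStrictOrderedRing R]
variable (ends : E → Sym2 V) (o a₁ a₂ a₃ b : V)

/-- The kernel on the side restrictions: `KB` on the glued side states. -/
noncomputable def sideΦ2 (WO WB : Set V) :
    Config E → Config E → Config E → Config E → Config E → Config E → R :=
  fun xa ya wa xb yb wb =>
    ((KB (glued2 (oSt2 ends o a₁ a₂ WO xa) (bSt ends a₁ a₂ a₃ b WB xb))
      (glued2 (oSt2 ends o a₁ a₂ WO ya) (bSt ends a₁ a₂ a₃ b WB yb))
      (glued2 (oSt2 ends o a₁ a₂ WO wa) (bSt ends a₁ a₂ a₃ b WB wb)) : ℤ) : R)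

variable {ends o a₁ a₂ a₃ b}

omit [Fintype E] [LinearOrder R] [IsStrictOrderedRing R] in
/-- The o-side state only sees the o-side typed edges. -/
lemma oSt2_restr (WO : Set V) {F : Finset E} {z x : Config E} (hx : ∀ e, e ∉ F → x e = z e) :
    oSt2 ends o a₁ a₂ WO (restr (sideF ends WO F) z x) = oSt2 ends o a₁ a₂ WO x := by
  unfold oSt2
  rw [withinRestr_restr_eq ends WO hx]

omit [Fintype E] [LinearOrder R] [IsStrictOrderedRing R] in
/-- **`K₃` on the support of a (SEP-2) split is a side kernel.** -/
theorem K3_eq_side2 {WO WB : Set V} {F : Finset E} {z : Config E}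
    (h : Split2 ends o a₁ a₂ a₃ b WO WB F z) {x y w : Config E}
    (hx : ∀ e, e ∉ F → x e = z e) (hy : ∀ e, e ∉ F → y e = z e) (hw : ∀ e, e ∉ F → w e = z e) :
    (K3 ends o a₁ a₂ a₃ b x y w : R) =
      sideKernel (sideF ends WO F) (sideF ends WB F) z (sideΦ2 ends o a₁ a₂ a₃ b WO WB) x y w := by
  rw [K3_eq_KB, st_eq_sep2St h (le_zF hx), st_eq_sep2St h (le_zF hy), st_eq_sep2St h (le_zF hw)]
  unfold sideKernel sideΦ2
  rw [oSt2_restr WO hx, oSt2_restr WO hy, oSt2_restr WO hw, bSt_restr WB hx, bSt_restr WB hy,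
    bSt_restr WB hw]

omit [Fintype E] [DecidableEq E] [LinearOrder R] [IsStrictOrderedRing R] in
/-- The doubly symmetrised side kernel is `dsym2` on the side states. -/
lemma symB_symA_sideΦ2 (WO WB : Set V) (xa ya wa xb yb wb : Config E) :
    symB (symA (sideΦ2 ends o a₁ a₂ a₃ b WO WB)) xa ya wa xb yb wb =
      ((dsym2 (oSt2 ends o a₁ a₂ WO xa) (oSt2 ends o a₁ a₂ WO ya) (oSt2 ends o a₁ a₂ WO wa)
        (bSt ends a₁ a₂ a₃ b WB xb) (bSt ends a₁ a₂ a₃ b WB yb)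
        (bSt ends a₁ a₂ a₃ b WB wb) : ℤ) : R) := by
  unfold symB symA sideΦ2 dsym2 psi2
  push_cast
  ring

omit [Fintype E] [DecidableEq E] [LinearOrder R] [IsStrictOrderedRing R] in
/-- The doubly symmetrised side kernel vanishes. -/
lemma symB_symA_sideΦ2_eq_zero (WO WB : Set V) (xa ya wa xb yb wb : Config E) :
    symB (symA (sideΦ2 ends o a₁ a₂ a₃ b WO WB)) xa ya wa xb yb wb = (0 : R) := by
  rw [symB_symA_sideΦ2, dsym2_eq_zero _ _ _ _ _ _ (validO_oSt2 WO xa) (validO_oSt2 WO ya)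
    (validO_oSt2 WO wa) (validB_bSt WB xb) (validB_bSt WB yb) (validB_bSt WB wb)]
  simp

/-- **THE TYPED (SEP-2) ZERO (a₃ on the b-side)**: on a split support whose doors are the roots,
with `o` alone on its side, every typed base of `K₃` vanishes, for every pinning and every type
map. -/
theorem typedCount_eq_zero_of_split2 {WO WB : Set V} (F : Finset E) (z : Config E) (τ : E → ℕ)
    (h : Split2 ends o a₁ a₂ a₃ b WO WB F z) :
    typedCount F z τ (K3 ends o a₁ a₂ a₃ b : Config E → Config E → Config E → R) = 0 := by
  set A := sideF ends WO F with hA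
  set B := sideF ends WB F with hB
  have hAF : A ⊆ F := Finset.filter_subset _ _
  have hBF : B ⊆ F := Finset.filter_subset _ _
  have hAB : Disjoint A B := by
    rw [Finset.disjoint_left]
    intro e heA heB
    simp only [hA, hB, sideF, Finset.mem_filter] at heA heB
    exact h.noloop e heA.1 ⟨heA.2, heB.2⟩
  have hker : typedCount F z τ (K3 ends o a₁ a₂ a₃ b : Config E → Config E → Config E → R) =
      typedCount F z τ (sideKernel A B z (sideΦ2 ends o a₁ a₂ a₃ b WO WB)) := by
    refine typedCount_congr_on_support F z τ fun x y w hc _ => ?_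
    exact K3_eq_side2 h (fun e he => (hc e he).1) (fun e he => (hc e he).2.1)
      (fun e he => (hc e he).2.2)
  rw [hker]
  exact typedCount_side_eq_zero F hAF hBF hAB z τ _
    (fun xa ya wa xb yb wb => symB_symA_sideΦ2_eq_zero WO WB xa ya wa xb yb wb)

variable (ends o a₁ a₂ a₃ b)

/-- **The class of the typed graph `(V, F)`**: the roots separate `o` from `{a₃, b}`. -/
def HasSepTwoB (F : Finset E) : Prop :=
  ∃ WO WB : Set V, Split2 ends o a₁ a₂ a₃ b WO WB F (fun _ => false)

/-- **Every typed base vanishes on `HasSepTwoB` at `z ≡ false`.** -/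
theorem typedCount_eq_zero_of_hasSepTwoB (F : Finset E) (τ : E → ℕ)
    (h : HasSepTwoB ends o a₁ a₂ a₃ b F) :
    typedCount F (fun _ => false) τ
      (K3 ends o a₁ a₂ a₃ b : Config E → Config E → Config E → R) = 0 := by
  obtain ⟨WO, WB, hs⟩ := h
  exact typedCount_eq_zero_of_split2 F _ τ hs

/-- Row 2′TRI (nonnegativity) on the class, as a consequence of the exact zero. -/
theorem typedCount_nonneg_of_hasSepTwoB (F : Finset E) (τ : E → ℕ)
    (h : HasSepTwoB ends o a₁ a₂ a₃ b F) :
    0 ≤ typedCount F (fun _ => false) τ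
      (K3 ends o a₁ a₂ a₃ b : Config E → Config E → Config E → R) :=
  le_of_eq (typedCount_eq_zero_of_hasSepTwoB ends o a₁ a₂ a₃ b F τ h).symm

end Main

end SepTwo

end CovForm

end Summit.Ventures.PercRepro2
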